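import Summits.Langlands.Langlands.Theorems.IrreducibilityBySelfDualityPairLBoundaryJSGlobalPairTranslateGen
import Literature.NumberTheory.Automorphic.PairLFunctionMeromorphicContinuationLocalReduction
import Literature.NumberTheory.Automorphic.PairLFunctionMeromorphicContinuationNeConjLocalReduction
import Literature.NumberTheory.Automorphic.PairLFunctionBoundaryRegularized
import Literature.NumberTheory.Automorphic.RankinSelbergTorusPairTranslate
import Literature.NumberTheory.Automorphic.RankinSelbergTorusHolomorphy

/-!
# Mœglin–Waldspurger (ii) from the POINTWISE local Rankin–Selberg datum in translate form

Summit `Langlands`, sub-problem `Langlands`, helper file under `Theorems/` supporting the crux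
`PairLBoundaryJS` (stmt-Langlands-13622, Arthur–Clozel (1989), Ch. 3, (2.2)), line `Sketch`,
registered stub `stub_eq_conj_of_local_translate_at` (skeleton v24, leaf hC).

`EqConjOfLocalTranslateAt.stub_eq_conj_of_local_translate_at` (**main**) derives the named fact
`Literature.NumberTheory.Automorphic.MoeglinWaldspurger1989_partialPairL_of_eq_conj`
(Mœglin–Waldspurger (1989), Appendice, Corollaire (ii): `s (s - 1) L^S(s, π ⊗ σ)` is entire for
`π = σ̄`; Cogdell (2004), Thm. 4.2, proof for `m = n`) from ONE hypothesis, the local Rankin–Selberg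
theory of a cuspidal pair in translate form AT EVERY POINT `s₀ ∈ ℂ` (registered stub
`stub_local_pair_translate_at` of the skeleton): for cuspidal `P`, `Q ≤ L²_cusp(GL_{n+1})` with
`P ⟂ Q` or `P = Q`, a finite `S₀` off which both are unramified and a point `s₀`, a torus of
Whittaker shifts `τ` (conductor-correcting off `S₀`), data `(f_i, f'_i, η_i, Φ_i)` of one level `𝔫₀`
supported on `S₀`, `Φ_i ≥ 0` Schwartz–Bruhat spherical off `S₀`, constants `c_i` and ENTIRE `Λ`, `h`
with `h(s₀) ≠ 0` and `Λ(s) Σ_i c_i Ψ^τ_{S₀,i}(s) = h(s)` for `re s > 1`. The global input is the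
LANDED translate global theorem `GlobalPairTranslateGen.stub_global_pair_translate_gen` (Cogdell
(2004), §2.3 Thm. 2.1–2.2, §3.1, §4.2; Jacquet–Shalika (1981), §4): entire `F` with
`F(s) = s (s - 1) · C · w_s(τ) · L^{S'}(s, α ⊗ γ̄) · Ψ^τ_{S'}(s)` on the strip `1 < re s < 2`.

Proof (the re-run of `EqConjOfLocalTranslate.stub_eq_conj_of_local_translate` at every point,
patched by `exists_differentiable_eqOn_of_entire_quotients`): for the datum `(P, P', S, α, β)` of
rank `n = r + 1`, let `S₀` be the finite set of places ramified for `P` or `P'`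
(`finite_setOf_not_isUnramifiedAt_or`) and `α₀`, `β₀` Satake families off it
(`exists_isSatakeFamilyOf_pair_ramified`); by
`exists_entire_regularized_partialPairL_of_ramified_datum` it suffices to continue
`L₀(s) = s (s - 1) L^{S₀}(s, α₀ ⊗ β₀)`, and by `exists_differentiable_eqOn_of_entire_quotients` it
suffices to produce, for every `s₀`, entire `G₀`, `h` with `h(s₀) ≠ 0` and `G₀ = h · L₀` on
`re s > 1`. With the Borel σ-algebra on `𝔸_K` and Haar measures chosen inside, the hypothesis at
`(P, P'.conj)`, `S₀`, `s₀` gives `τ, c_i, f_i, f'_i, 𝔫₀, η_i, Φ_i, Λ, h`; the global theorem at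
`S' = S₀`, `γ = β̄₀` (common unitary central scalars since `f_i, f'_i` lie in the one representation
`P = P'.conj`, `CuspidalAutomorphicRepGL.exists_central_scalar`) gives entire `F_i` with
`F_i(s) = s (s - 1) C w_s(τ) L^{S₀}(s, α₀ ⊗ β₀) Ψ^τ_{S₀,i}(s)` on the strip, whence
`G₀ = C⁻¹ w_s(τ)⁻¹ Λ Σ_i c_i F_i` is entire (`differentiable_torusWeightC`, `torusWeightC_ne_zero`)
and equals `h(s) · s (s - 1) L^{S₀}` on the strip, hence on `re s > 1`
(`eq_mul_partialPairL_of_eqOn_strip`).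

## References

* C. Mœglin, J.-L. Waldspurger, *Le spectre résiduel de `GL(n)`*, Ann. Sci. École Norm. Sup. (4)
  22 (1989), 605–674: Appendice, Corollaire (ii), p. 667. [MoeglinWaldspurger1989]
* J. W. Cogdell, *Analytic theory of `L`-functions for `GL_n`*, in: An Introduction to the
  Langlands Program (Birkhäuser, 2004), §2.3 Thm. 2.1–2.2, §3 Thm. 3.1, 3.3, §4.1–§4.2, Thm. 4.2.
  [CogdellAnalyticTheory2004]
* H. Jacquet, I. I. Piatetski-Shapiro, J. A. Shalika, *Rankin–Selberg convolutions*, Amer. J. Math.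
  105 (1983), 367–464, Thm. 2.7. [JPSS1983]
-/

noncomputable section

-- `Summit.Langlands.Langlands.…` (summit = sub-problem name, D-0017 layout) trips `dupNamespace`
set_option linter.dupNamespace false

open scoped MatrixGroups Topology Pointwise ENNReal NNReal ComplexConjugate InnerProductSpace ContDiff
-- the place subtypes indexing `mixedSpace K` are `Fintype` classically (`NormedCommRing (mixedSpace K)`)
open scoped Classical Matrix.Norms.Operator
open NumberField IsDedekindDomain MeasureTheory Measure Matrix Set Filter WithZero
open NumberField.mixedEmbedding
open Literature.NumberTheory.Automorphic AdelicGroupData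
open Literature.NumberTheory.GaloisRepresentations (ideleGroup HeckeCharacter)
open ValuativeRel

-- the automorphic quotient carries the tree's Borel σ-algebra, not Mathlib's quotient σ-algebra
attribute [-instance] Quotient.instMeasurableSpace QuotientGroup.measurableSpace

-- the house local instances, exactly as in `RankinSelbergUnfoldingIdentity`
attribute [local instance] adelicBorel borelSpace_adelic locallyCompactSpace_adelic secondCountableTopology_gl_adelic
  glAdeleBorel borelSpace_glAdele borelSpace_ideleGroup secondCountableTopology_ideleGroup

-- Mathlib idiom: the commutator Lie ring on matrices, to mention `(archGroupGL n K).lie`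
attribute [local instance 100] LieRing.ofAssociativeRing

namespace Summit.Langlands.Langlands.Theorems.EqConjOfLocalTranslateAt

/-- **Mœglin–Waldspurger, Corollaire (ii) (`MoeglinWaldspurger1989_partialPairL_of_eq_conj`) from
the pointwise local Rankin–Selberg datum of a cuspidal pair in translate form and the translate
global theorem.** Assume the local theory (hypothesis): for cuspidal `P`, `Q ≤ L²_cusp(GL_{n+1}(𝔸_K))`
with `P ⟂ Q` or `P = Q`, every finite `S₀` off which both are unramified and every `s₀ ∈ ℂ`, there
are a torus element `τ` with last entry `1` realising conductor-correcting Whittaker shifts off `S₀`,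
finitely many `c_i ∈ ℂ`, `f_i ∈ P`, `f'_i ∈ Q`, one level `𝔫₀ ≠ 0` supported on `S₀`, test functions
`η_i` of level `K(𝔫₀)`, real `Φ_i ≥ 0` continuous Schwartz–Bruhat spherical with integral support
off `S₀`, and entire `Λ`, `h` with `h(s₀) ≠ 0` and
`Λ(s) · Σ_i c_i ∫_{B({v ∉ S₀}) × K} W_i(diag τ ·) W̄'_i(diag τ ·) Φ_i |det|^s δ⁻¹ = h(s)` for
`re s > 1`. Then for all cuspidal `π = σ̄` on `GL_n(𝔸_K)` (`0 < n`), every finite `S` and Satake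
families `α`, `β` off `S`, `s (s - 1) L^S(s, α ⊗ β)` extends to an entire function. Proof:
`n = r + 1`; reduce to the ramified set `S₀` of the pair with Satake families `α₀`, `β₀`
(`exists_entire_regularized_partialPairL_of_ramified_datum`) and to entire quotient data at every
point `s₀` (`exists_differentiable_eqOn_of_entire_quotients`); Borel σ-algebra and Haar measures
inside; the hypothesis at `(P, P'.conj)`, `S₀`, `s₀`; the landed
`GlobalPairTranslateGen.stub_global_pair_translate_gen` at `S' = S₀`, `γ = β̄₀` and the common central
scalars of `P = P'.conj` gives entire `F_i = s (s - 1) C w_s(τ) L^{S₀} Ψ^τ_{S₀,i}` on the strip, so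
`G₀ = C⁻¹ w_s(τ)⁻¹ Λ Σ_i c_i F_i` is entire and equals `h(s) · s (s - 1) L^{S₀}(s, α₀ ⊗ β₀)` on the
strip, hence on `re s > 1` (`eq_mul_partialPairL_of_eqOn_strip`). Cogdell (2004), §4.2, proof of
Thm. 4.2 for `m = n`; Mœglin–Waldspurger (1989), Appendice, Corollaire (ii), p. 667.
[cite: MoeglinWaldspurger1989, Appendice, Corollaire (ii), p. 667]
[cite: CogdellAnalyticTheory2004, §4.2, Thm. 4.2] -/
theorem stub_eq_conj_of_local_translate_at :
    (∀ {n : ℕ} {K : Type} [Field K] [NumberField K]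
      {μ : Measure (AdelicGroupData.gl (n + 1) K).automorphicQuotient} [(AdelicGroupData.gl (n + 1) K).IsAutomorphicMeasure μ]
      [MeasurableSpace (AdeleRing (𝓞 K) K)] [BorelSpace (AdeleRing (𝓞 K) K)]
      (νA : Measure (Fin (n + 1) → ideleGroup K)) [IsHaarMeasure νA]
      (νK : Measure ↥(maximalCompactAdelic (n + 1) K)) [IsHaarMeasure νK]
      (ν₀ : Measure ↥(adelicUnipotent (n + 1) K)) [IsHaarMeasure ν₀]
      (P Q : CuspidalAutomorphicRepGL (n + 1) K μ), (P.1.toSubmodule ⟂ Q.1.toSubmodule ∨ P = Q) →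
      ∀ (S₀ : Finset (HeightOneSpectrum (𝓞 K))), (∀ v ∉ S₀, IsUnramifiedAt P.1 v ∧ IsUnramifiedAt Q.1 v) →
      ∀ (s₀ : ℂ),
      ∃ (τ : Fin (n + 1) → ideleGroup K), lastEntry τ = 1 ∧
      (∀ v ∉ S₀, ∃ (d : Fin (n + 1) → (v.adicCompletion K)ˣ) (a : (v.adicCompletion K)ˣ),
        localComponent v (glDiagonal (n + 1) (AdeleRing (𝓞 K) K) τ) = diagonalGL (Fin (n + 1)) (v.adicCompletion K) d ∧
        (∀ i j : Fin (n + 1), (i : ℕ) + 1 = j → (d i : v.adicCompletion K) * ((d j)⁻¹ : (v.adicCompletion K)ˣ) = a) ∧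
        (∀ c ∈ 𝒪[v.adicCompletion K], (adeleAddChar K).adicComponent v (a * c) = 1) ∧
        ∀ ϖ : v.adicCompletion K, Valued.v ϖ = WithZero.exp (-1 : ℤ) →
          ∃ c ∈ 𝒪[v.adicCompletion K], (adeleAddChar K).adicComponent v (a * (ϖ⁻¹ * c)) ≠ 1) ∧
      ∃ (k : ℕ) (c : Fin k → ℂ) (f : Fin k → P.1.toSubmodule) (f' : Fin k → Q.1.toSubmodule) (𝔫₀ : Ideal (𝓞 K)),
      𝔫₀ ≠ 0 ∧ (∀ w : HeightOneSpectrum (𝓞 K), w.asIdeal ∣ 𝔫₀ → w ∈ S₀) ∧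
      ∃ (η : Fin k → (AdelicGroupData.gl (n + 1) K).Adelic → ℝ), (∀ i, IsTestFunctionGL (n + 1) K (η i)) ∧
      (∀ i, ∀ u : (AdelicGroupData.gl (n + 1) K).Adelic, u ∈ principalCongruenceLevel (n + 1) K 𝔫₀ → ∀ g : (AdelicGroupData.gl (n + 1) K).Adelic, η i (u * g) = η i g) ∧
      ∃ (Φ : Fin k → (Fin (n + 1) → AdeleRing (𝓞 K) K) → ℝ), (∀ i, Continuous (Φ i)) ∧ (∀ i y, 0 ≤ Φ i y) ∧
      (∀ i, (fun y => ((Φ i y : ℝ) : ℂ)) ∈ piSchwartzBruhat K (Fin (n + 1))) ∧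
      (∀ i, ∀ v ∉ S₀, IsLastRowSphericalAt (n + 1) K (Φ i) v) ∧
      (∀ i, ∀ v ∉ S₀, ∀ y : Fin (n + 1) → AdeleRing (𝓞 K) K, Φ i y ≠ 0 → ∀ j, Valued.v ((y j).2 v) ≤ 1) ∧
      ∃ Λ h : ℂ → ℂ, Differentiable ℂ Λ ∧ Differentiable ℂ h ∧ h s₀ ≠ 0 ∧ ∀ s : ℂ, 1 < s.re →
      Λ s * ∑ i, c i * ∫ p in unitBox {v | v ∉ (↑S₀ : Set (HeightOneSpectrum (𝓞 K)))} ×ˢ Set.univ,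
        torusPairIntegrandC (n + 1) K
          (fun g => whittakerCoeff ν₀ (unipotentTateDomain (n + 1) K) (adeleAddChar K) (invQuot (AdelicGroupData.gl (n + 1) K) (smoothedForm (η i) ((f i : P.1.toSubmodule) : (AdelicGroupData.gl (n + 1) K).L2 μ))) (glDiagonal (n + 1) (AdeleRing (𝓞 K) K) τ * g))
          (fun g => star (whittakerCoeff ν₀ (unipotentTateDomain (n + 1) K) (adeleAddChar K) (invQuot (AdelicGroupData.gl (n + 1) K) (smoothedForm (η i) ((f' i : Q.1.toSubmodule) : (AdelicGroupData.gl (n + 1) K).L2 μ)))) (glDiagonal (n + 1) (AdeleRing (𝓞 K) K) τ * g))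
          (Φ i) s p ∂(νA.prod νK) = h s) →
    ∀ {n : ℕ} {K : Type} [Field K] [NumberField K]
      {μ : Measure (AdelicGroupData.gl n K).automorphicQuotient} [(AdelicGroupData.gl n K).IsAutomorphicMeasure μ],
      MoeglinWaldspurger1989_partialPairL_of_eq_conj (n := n) (K := K) (μ := μ) := by
  intro hloc n K _ _ μ _ hn P P' he S hS α β hα hβ
  -- the rank is positive: `n = r + 1`
  obtain ⟨r, rfl⟩ : ∃ r, n = r + 1 := ⟨n - 1, by omega⟩
  classical
  -- topological and measurable structures (verbatim `…_of_eq_conj_of_local`)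
  haveI : T2Space (GL (Fin (r + 1)) (AdeleRing (𝓞 K) K)) := t2Space_gl (r + 1) K
  haveI : LocallyCompactSpace (GL (Fin (r + 1)) (AdeleRing (𝓞 K) K)) :=
    AdelicGroupData.locallyCompactSpace_generalLinearGroup_adeleRing K (Fin (r + 1))
  haveI := secondCountableTopology_generalLinearGroup_adeleRing K (Fin (r + 1))
  haveI : T2Space (AdeleRing (𝓞 K) K) := t2Space_adeleRing K
  letI : MeasurableSpace (AdeleRing (𝓞 K) K) := borel _
  haveI : BorelSpace (AdeleRing (𝓞 K) K) := ⟨rfl⟩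
  haveI := borelSpace_ideleGroup K
  haveI := locallyCompactSpace_ideleGroup K
  haveI := secondCountableTopology_ideleGroup K
  haveI := secondCountableTopology_adeleRing K
  haveI := locallyCompactSpace_adeleRing' K
  haveI : CompactSpace ↥(maximalCompactAdelic (r + 1) K) :=
    isCompact_iff_compactSpace.1 (isCompact_maximalCompactAdelic (r + 1) K)
  haveI : LocallyCompactSpace ↥(adelicUnipotent (r + 1) K) :=
    (isClosed_adelicUnipotent (r + 1) K).locallyCompactSpace
  -- Haar measures
  obtain ⟨νI, hνI⟩ := exists_isHaarMeasure_ideleGroup K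
  set νA : Measure (Fin (r + 1) → ideleGroup K) := Measure.haar with hνA
  set νK : Measure ↥(maximalCompactAdelic (r + 1) K) := Measure.haar with hνK
  set ν₀ : Measure ↥(adelicUnipotent (r + 1) K) := Measure.haar with hν₀
  -- reduction to the ramified datum `(S₀, α₀, β₀)` of the pair
  obtain ⟨α₀, β₀, hα₀', hβ₀'⟩ := exists_isSatakeFamilyOf_pair_ramified P P'
  have hfin : {v : HeightOneSpectrum (𝓞 K) | ¬ IsUnramifiedAt P.1 v ∨ ¬ IsUnramifiedAt P'.1 v}.Finite :=
    finite_setOf_not_isUnramifiedAt_or P P'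
  set S₀ : Finset (HeightOneSpectrum (𝓞 K)) := hfin.toFinset with hS₀def
  have hcoe : (↑S₀ : Set (HeightOneSpectrum (𝓞 K))) =
      {v : HeightOneSpectrum (𝓞 K) | ¬ IsUnramifiedAt P.1 v ∨ ¬ IsUnramifiedAt P'.1 v} :=
    hfin.coe_toFinset
  have hα₀ : IsSatakeFamilyOf P (↑S₀ : Set (HeightOneSpectrum (𝓞 K))) α₀ := hα₀'.mono hcoe.symm.subset
  have hβ₀ : IsSatakeFamilyOf P' (↑S₀ : Set (HeightOneSpectrum (𝓞 K))) β₀ := hβ₀'.mono hcoe.symm.subset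
  have hram : ∀ v ∈ (↑S₀ : Set (HeightOneSpectrum (𝓞 K))), ¬ IsUnramifiedAt P.1 v ∨ ¬ IsUnramifiedAt P'.1 v :=
    fun v hv => hfin.mem_toFinset.1 (Finset.mem_coe.1 hv)
  refine exists_entire_regularized_partialPairL_of_ramified_datum P P'
    (S₀ := (↑S₀ : Set (HeightOneSpectrum (𝓞 K)))) hram hα₀ hβ₀ ?_ hS hα hβ
  -- patching entire quotient data `(G₀, h)` for `s (s - 1) L^{S₀}(s, α₀ ⊗ β₀)` at every point `s₀`
  refine exists_differentiable_eqOn_of_entire_quotients (x₀ := 1)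
    (L := fun s => s * (s - 1) * partialPairL (↑S₀ : Set (HeightOneSpectrum (𝓞 K))) α₀ β₀ s) fun s₀ => ?_
  -- both `P` and `P'.conj = P` are unramified off `S₀`
  have hunr : ∀ v ∉ S₀, IsUnramifiedAt P.1 v ∧ IsUnramifiedAt P'.conj.1 v := by
    intro v hv
    have hv' : ¬ (¬ IsUnramifiedAt P.1 v ∨ ¬ IsUnramifiedAt P'.1 v) := fun h => hv (hfin.mem_toFinset.2 h)
    push Not at hv'
    exact ⟨hv'.1, isUnramifiedAt_conj_iff.2 hv'.2⟩
  -- the local datum in translate form for the pair `(P, P'.conj)`, `P = P'.conj`, at the point `s₀`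
  obtain ⟨τ, hτ1, hτψ, k, c, f, f', 𝔫₀, h𝔫₀, h𝔫₀S, η, hη, hηK, Φ, hΦc, hΦ0, hΦS, hΦsph, hΦv,
      Λ, h, hΛ, hh, hh0, hΛsum⟩ :=
    hloc νA νK ν₀ P P'.conj (Or.inr he) S₀ hunr s₀
  -- the translate global Rankin–Selberg theorem (general test function)
  obtain ⟨C, hC, hT⟩ := GlobalPairTranslateGen.stub_global_pair_translate_gen hn μ νI νA νK ν₀
  -- `f_i` and `f'_i` lie in the one representation `P = P'.conj`: common unitary central scalars
  have hZ : ∀ (i : Fin k) (z : ideleGroup K), ∃ d : ℂ, ‖d‖ = 1 ∧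
      (AdelicGroupData.gl (r + 1) K).rightRegular μ (Matrix.GeneralLinearGroup.scalar (Fin (r + 1)) z)
          ((f i : P.1.toSubmodule) : (AdelicGroupData.gl (r + 1) K).L2 μ) =
        d • ((f i : P.1.toSubmodule) : (AdelicGroupData.gl (r + 1) K).L2 μ) ∧
      (AdelicGroupData.gl (r + 1) K).rightRegular μ (Matrix.GeneralLinearGroup.scalar (Fin (r + 1)) z)
          ((f' i : P'.conj.1.toSubmodule) : (AdelicGroupData.gl (r + 1) K).L2 μ) =
        d • ((f' i : P'.conj.1.toSubmodule) : (AdelicGroupData.gl (r + 1) K).L2 μ) := by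
    have key : ∀ (Q : CuspidalAutomorphicRepGL (r + 1) K μ), P = Q →
        ∀ (g : P.1.toSubmodule) (g' : Q.1.toSubmodule) (z : ideleGroup K), ∃ d : ℂ, ‖d‖ = 1 ∧
        (AdelicGroupData.gl (r + 1) K).rightRegular μ (Matrix.GeneralLinearGroup.scalar (Fin (r + 1)) z)
            (g : (AdelicGroupData.gl (r + 1) K).L2 μ) = d • (g : (AdelicGroupData.gl (r + 1) K).L2 μ) ∧
        (AdelicGroupData.gl (r + 1) K).rightRegular μ (Matrix.GeneralLinearGroup.scalar (Fin (r + 1)) z)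
            (g' : (AdelicGroupData.gl (r + 1) K).L2 μ) = d • (g' : (AdelicGroupData.gl (r + 1) K).L2 μ) := by
      rintro Q rfl g g' z
      exact P.exists_central_scalar g g' z
    exact fun i z => key P'.conj he (f i) (f' i) z
  -- the level `𝔫₀` is supported on `S₀`
  have hS' : ∀ v ∉ (↑S₀ : Set (HeightOneSpectrum (𝓞 K))), ¬ v.asIdeal ∣ 𝔫₀ :=
    fun v hv hd => hv (Finset.mem_coe.2 (h𝔫₀S v hd))
  -- enumerations of the Satake parameters `α₀`, `β̄₀` off `S₀`
  have hex : ∀ v : HeightOneSpectrum (𝓞 K), ∃ x : Fin (r + 1) → ℂ,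
      v ∉ (↑S₀ : Set (HeightOneSpectrum (𝓞 K))) → (Finset.univ : Finset (Fin (r + 1))).val.map x = α₀ v := by
    intro v
    by_cases hv : v ∉ (↑S₀ : Set (HeightOneSpectrum (𝓞 K)))
    · obtain ⟨x, hx⟩ := exists_univ_val_map_eq (hα₀.card_eq hv)
      exact ⟨x, fun _ => hx⟩
    · exact ⟨fun _ => 0, fun h => absurd h hv⟩
  choose x hx using hex
  have hey : ∀ v : HeightOneSpectrum (𝓞 K), ∃ y : Fin (r + 1) → ℂ,
      v ∉ (↑S₀ : Set (HeightOneSpectrum (𝓞 K))) →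
        (Finset.univ : Finset (Fin (r + 1))).val.map y = (β₀ v).map conj := by
    intro v
    by_cases hv : v ∉ (↑S₀ : Set (HeightOneSpectrum (𝓞 K)))
    · obtain ⟨y, hy⟩ := exists_univ_val_map_eq (hβ₀.conj.card_eq hv)
      exact ⟨y, fun _ => hy⟩
    · exact ⟨fun _ => 0, fun h => absurd h hv⟩
  choose y hy using hey
  -- the entire `F_i` of the global theorem for `(f_i, f'_i)`, `S' = S₀`, `γ = β̄₀`
  choose F hF hFI hFstrip using fun i : Fin k => hT P P'.conj (f i) (f' i) (hZ i) hα₀ hβ₀.conj h𝔫₀ (hη i) (hηK i)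
      subset_rfl hS' τ hτ1 (fun v hv => hτψ v hv) (fun v hv => hx v hv) (fun v hv => hy v hv) (hΦc i) (hΦ0 i)
      (hΦS i) (fun v hv => hΦsph i v hv) (fun v hv => hΦv i v hv)
  -- `∑ c_i F_i = s (s - 1) · C · w_s(τ) · L^{S₀} · ∑ c_i Ψ_i` on the strip
  have hββ : (fun v => ((β₀ v).map conj).map conj) = β₀ := funext fun v => multiset_map_conj_map_conj _
  have hsum : ∀ s : ℂ, 1 < s.re → s.re < 2 → ∑ i, c i * F i s =
      (s * (s - 1) * ((C : ℂ) * (torusWeightC (r + 1) K s τ *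
        partialPairL (↑S₀ : Set (HeightOneSpectrum (𝓞 K))) α₀ β₀ s))) *
      ∑ i, c i * ∫ p in unitBox {v | v ∉ (↑S₀ : Set (HeightOneSpectrum (𝓞 K)))} ×ˢ Set.univ,
        torusPairIntegrandC (r + 1) K
          (fun g => whittakerCoeff ν₀ (unipotentTateDomain (r + 1) K) (adeleAddChar K)
            (invQuot (AdelicGroupData.gl (r + 1) K) (smoothedForm (η i)
              ((f i : P.1.toSubmodule) : (AdelicGroupData.gl (r + 1) K).L2 μ)))
            (glDiagonal (r + 1) (AdeleRing (𝓞 K) K) τ * g))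
          (fun g => star (whittakerCoeff ν₀ (unipotentTateDomain (r + 1) K) (adeleAddChar K)
            (invQuot (AdelicGroupData.gl (r + 1) K) (smoothedForm (η i)
              ((f' i : P'.conj.1.toSubmodule) : (AdelicGroupData.gl (r + 1) K).L2 μ))))
            (glDiagonal (r + 1) (AdeleRing (𝓞 K) K) τ * g))
          (Φ i) s p ∂(νA.prod νK) := by
    intro s hs1 hs2
    rw [Finset.mul_sum]
    refine Finset.sum_congr rfl fun i _ => ?_
    have h := hFstrip i s hs1 hs2
    beta_reduce at h
    rw [hββ] at h
    rw [h]
    ring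
  -- the entire function `G₀ = C⁻¹ w_s(τ)⁻¹ Λ ∑ c_i F_i`
  set G₀ : ℂ → ℂ := fun s => (C : ℂ)⁻¹ * ((torusWeightC (r + 1) K s τ)⁻¹ * (Λ s * ∑ i, c i * F i s))
    with hG₀def
  have hC0 : (C : ℂ) ≠ 0 := Complex.ofReal_ne_zero.2 hC.ne'
  have hsumF : Differentiable ℂ fun s => ∑ i, c i * F i s := by
    have h : Differentiable ℂ (∑ i, fun s => c i * F i s) := Differentiable.sum fun i _ => (hF i).const_mul (c i)
    convert h using 1
    funext s
    simp only [Finset.sum_apply]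
  have hw : Differentiable ℂ fun s => (torusWeightC (r + 1) K s τ)⁻¹ :=
    (differentiable_torusWeightC τ).inv fun s => torusWeightC_ne_zero s τ
  have hG₀ : Differentiable ℂ G₀ := by
    show Differentiable ℂ fun s => (C : ℂ)⁻¹ * ((torusWeightC (r + 1) K s τ)⁻¹ * (Λ s * ∑ i, c i * F i s))
    exact (hw.mul (hΛ.mul hsumF)).const_mul _
  -- `G₀ = h · s (s - 1) L^{S₀}` on the strip
  have hG₀strip : ∀ s : ℂ, 1 < s.re → s.re < 2 →
      G₀ s = h s * (s * (s - 1)) * partialPairL (↑S₀ : Set (HeightOneSpectrum (𝓞 K))) α₀ β₀ s := by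
    intro s hs1 hs2
    have h1 := hΛsum s hs1
    have hw0 : torusWeightC (r + 1) K s τ ≠ 0 := torusWeightC_ne_zero s τ
    show (C : ℂ)⁻¹ * ((torusWeightC (r + 1) K s τ)⁻¹ * (Λ s * ∑ i, c i * F i s)) = _
    rw [hsum s hs1 hs2, mul_left_comm (Λ s), h1]
    field_simp
  -- hence on `re s > 1`
  have hA : Differentiable ℂ fun s : ℂ => h s * (s * (s - 1)) :=
    hh.mul (differentiable_id.mul (differentiable_id.sub_const 1))
  have hG₀L : ∀ s : ℂ, 1 < s.re →
      G₀ s = h s * (s * (s - 1)) * partialPairL (↑S₀ : Set (HeightOneSpectrum (𝓞 K))) α₀ β₀ s :=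
    eq_mul_partialPairL_of_eqOn_strip P P' hα₀ hβ₀ hG₀ hA hG₀strip
  refine ⟨G₀, h, hG₀, hh, hh0, fun s hs => ?_⟩
  show G₀ s = h s * (s * (s - 1) * partialPairL (↑S₀ : Set (HeightOneSpectrum (𝓞 K))) α₀ β₀ s)
  rw [hG₀L s hs, mul_assoc]

end Summit.Langlands.Langlands.Theorems.EqConjOfLocalTranslateAt

end
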